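import Literature.AlgebraicGeometry.Resolution.Macaulayfication
import HarnessLib

/-!
# Macaulayfication that is an isomorphism over the Cohen–Macaulay locus (Česnavičius 2021) — named fact

Topic: `Literature/AlgebraicGeometry/Resolution`. Companion of `Macaulayfication.lean`, which vendors
Macaulayfication in the WEAK form `KawasakiMacaulayfication` (Kawasaki 2000 Thm. 1.1: an integral scheme
separated and of finite type over a field has a proper birational integral Cohen–Macaulay model). The
sharp form proved by Česnavičius controls the ISOMORPHISM LOCUS of the Macaulayfication:

  *"Theorem 1.6. For every CM-quasi-excellent, Noetherian scheme `X`, there are a Cohen–Macaulay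
  scheme `X̃` and a birational, projective morphism `π : X̃ → X` that is an isomorphism over the
  Cohen–Macaulay locus `CM(X) ⊂ X`."* (arXiv:1810.04493v2 = Duke Math. J. 170 (2021); the precise
  form is Thm. 5.3: for `X` CM-excellent and locally equidimensional one may take `X̃ = Bl_Z(X)` for a
  closed subscheme `Z ⊂ X` disjoint from the dense open `CM(X)`, which is dense in `Bl_Z(X)` too.)

This is the form needed to DERIVE Česnavičius's principalization corollary (`§1`, Cor. (principalize);
vendored as the named fact `CesnaviciusPrincipalization` of `MacaulayficationPrincipalization.lean`)
inside the tree — Macaulayfy the blow-up `Bl_Z(X)`, which is an isomorphism off `Supp Z`, by a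
Macaulayfication that is an isomorphism over the Cohen–Macaulay open `Bl_Z(X) ∖ (preimage of Supp Z)
≅ X ∖ Supp Z` — so that the two Macaulayfication-type named facts used by route `FrobeniusLadder` of
summit `ResolutionOfSingularities` (rung 2: `KawasakiMacaulayfication`; rung 3, crux
`FRationalModification`, line `birth`: `CesnaviciusPrincipalization`) rest on ONE statement in print
(`kawasakiMacaulayfication_of_cesnaviciusMacaulayfication` below; the principalization derivation is
summit-side, `Summit…Theorems.FRationalModification.PrincipalizationOfMacaulayfication`).

Vendored as a NAMED FACT (`def … : Prop`, not proved in the tree), in the special case and the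
stalkwise inline vocabulary of `KawasakiMacaulayfication`:

* base = a field `k`, `X` INTEGRAL, separated and of finite type over `k` (finite-type `k`-schemes are
  excellent, Stacks 07QW, hence CM-excellent, Česnavičius 2021 Ex. 1.3 (CM-exc-eg); integral ⇒ locally
  equidimensional; so Thm. 5.3 applies with `X' = X`);
* "`X̃` Cohen–Macaulay" spelled stalkwise and inline exactly as in `KawasakiMacaulayfication` (every
  system of parameters of every local ring is a weakly regular sequence; Bruns–Herzog 2.1.2 (d),
  2.1.3 (b); Stacks 02IP);
* "`π` proper and BIRATIONAL" (`IsBirational` of this directory: an isomorphism over a dense open with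
  dense preimage — here `CM(X)`, dense open in the integral `X` and dense in `X̃ = Bl_Z(X)` by Thm. 5.3)
  and "`X̃` INTEGRAL" (a blow-up of the integral `X` in a closed subscheme `Z ≠ X`, Stacks 02ND) are
  recorded in the conclusion, as in `KawasakiMacaulayfication`;
* "isomorphism over `CM(X)`" is recorded WITHOUT introducing the Cohen–Macaulay locus as an object: for
  every open `U ⊆ X` all of whose stalks are Cohen–Macaulay (i.e. `U ⊆ CM(X)`), the restriction
  `π ∣_ U : π⁻¹(U) → U` is an isomorphism (`IsIso (π ∣_ U)`).

## Sources

* K. Česnavičius, *Macaulayfication of Noetherian schemes*, Duke Math. J. 170 (2021) 1419–1455 =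
  arXiv:1810.04493v2: **Theorem 1.6** (quoted above), Definition 1.2 (CM-quasi-excellence),
  Example 1.3 (quasi-excellent ⇒ CM-quasi-excellent; Cohen–Macaulay ⇒ CM-excellent), Theorem 5.3 and
  Remark 5.4 (the Macaulayfying blow-up `Bl_Z(X) → X`, `Z ∩ CM(X) = ∅`, `CM(X)` dense in `Bl_Z(X)`).
  [Cesnavicius2021]
* T. Kawasaki, *On Macaulayfication of Noetherian schemes*, Trans. AMS 352 (2000), Thm. 1.1 (the weak
  form). [Kawasaki2000]
* The Stacks Project, Tags 07QW, 02IP, 02ND.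

## What is NOT here

The proof (XL: Česnavičius's Noetherian induction / Kawasaki's p-standard sequences); the general base
(CM-quasi-excellent Noetherian `X`); projectivity of `π`; the Cohen–Macaulay locus as a subscheme and its
openness (EGA IV₂ 6.11.2) — the isomorphism clause quantifies over opens with Cohen–Macaulay stalks instead.
-/

noncomputable section

open CategoryTheory AlgebraicGeometry

namespace Literature.AlgebraicGeometry.Resolution

universe u

/-- NAMED FACT — **Macaulayfication that is an isomorphism over the Cohen–Macaulay locus**
(Česnavičius 2021, Thm. 1.6, special case `X` integral, separated and of finite type over a field `k`):
*"For every CM-quasi-excellent, Noetherian scheme `X`, there are a Cohen–Macaulay scheme `X̃` and a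
birational, projective morphism `π : X̃ → X` that is an isomorphism over the Cohen–Macaulay locus
`CM(X) ⊂ X`."* Rendering: a proper BIRATIONAL `π₁ : X₁ → X` with `X₁` integral, every system of
parameters of every stalk `𝒪_{X₁,x}` a weakly regular sequence (Cohen–Macaulay, Bruns–Herzog 2.1.2 (d)),
and `π₁ ∣_ U` an isomorphism for every open `U ⊆ X` all of whose stalks are Cohen–Macaulay in the same
sense (such `U` lie in `CM(X)`). Refines `KawasakiMacaulayfication` (drop the last clause). Users take
`(h : CesnaviciusMacaulayfication)`.
-- TODO(general form): X CM-quasi-excellent Noetherian, π projective, an isomorphism over all of CM(X)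
-- (Česnavičius 2021 Thm. 1.6; Thm. 5.3: X̃ = Bl_Z(X) with Z ∩ CM(X) = ∅ for X CM-excellent and
-- locally equidimensional).
[cite: Cesnavicius2021, Thm. 1.6; Thm. 5.3 and Rem. 5.4] -/
def CesnaviciusMacaulayfication : Prop :=
  ∀ (k : Type u) [Field k] (X : Scheme.{u}) (f : X ⟶ Spec (.of k)),
    IsSeparated f → LocallyOfFiniteType f → QuasiCompact f → IsIntegral X →
      ∃ (X₁ : Scheme.{u}) (π₁ : X₁ ⟶ X), IsProper π₁ ∧ IsBirational π₁ ∧ IsIntegral X₁ ∧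
        (∀ x : X₁, ∀ d : ℕ, ringKrullDim (X₁.presheaf.stalk x) = d →
          ∀ s : Fin d → X₁.presheaf.stalk x, (Ideal.span (Set.range s)).radical.IsMaximal →
            RingTheory.Sequence.IsWeaklyRegular (X₁.presheaf.stalk x) (List.ofFn s)) ∧
        ∀ U : X.Opens, (∀ x : X, x ∈ U → ∀ d : ℕ, ringKrullDim (X.presheaf.stalk x) = d →
          ∀ s : Fin d → X.presheaf.stalk x, (Ideal.span (Set.range s)).radical.IsMaximal →
            RingTheory.Sequence.IsWeaklyRegular (X.presheaf.stalk x) (List.ofFn s)) →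
          IsIso (π₁ ∣_ U)

/-- `CesnaviciusMacaulayfication` refines the weak form `KawasakiMacaulayfication` (Kawasaki 2000
Thm. 1.1, special case): forget the isomorphism clause. [cite: Cesnavicius2021, Thm. 1.6;
Kawasaki2000, Thm. 1.1] -/
theorem kawasakiMacaulayfication_of_cesnaviciusMacaulayfication (h : CesnaviciusMacaulayfication.{u}) :
    KawasakiMacaulayfication.{u} := by
  intro k _ X f hs hl hq hX
  obtain ⟨X₁, π₁, hπ, hbir, hX₁, hCM, -⟩ := h k X f hs hl hq hX
  exact ⟨X₁, π₁, hπ, hbir, hX₁, hCM⟩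

/-- The trivial instance (consistency of the rendering): if every stalk of the integral `X` is already
Cohen–Macaulay, then `X₁ = X`, `π₁ = 𝟙 X` is a Macaulayfication that is an isomorphism over every open
(restrictions of isomorphisms are isomorphisms). [folklore] -/
theorem cesnaviciusMacaulayfication_of_self (X : Scheme.{u}) [IsIntegral X]
    (hX : ∀ x : X, ∀ d : ℕ, ringKrullDim (X.presheaf.stalk x) = d →
      ∀ s : Fin d → X.presheaf.stalk x, (Ideal.span (Set.range s)).radical.IsMaximal →
        RingTheory.Sequence.IsWeaklyRegular (X.presheaf.stalk x) (List.ofFn s)) :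
    ∃ (X₁ : Scheme.{u}) (π₁ : X₁ ⟶ X), IsProper π₁ ∧ IsBirational π₁ ∧ IsIntegral X₁ ∧
      (∀ x : X₁, ∀ d : ℕ, ringKrullDim (X₁.presheaf.stalk x) = d →
        ∀ s : Fin d → X₁.presheaf.stalk x, (Ideal.span (Set.range s)).radical.IsMaximal →
          RingTheory.Sequence.IsWeaklyRegular (X₁.presheaf.stalk x) (List.ofFn s)) ∧
      ∀ U : X.Opens, (∀ x : X, x ∈ U → ∀ d : ℕ, ringKrullDim (X.presheaf.stalk x) = d →
        ∀ s : Fin d → X.presheaf.stalk x, (Ideal.span (Set.range s)).radical.IsMaximal →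
          RingTheory.Sequence.IsWeaklyRegular (X.presheaf.stalk x) (List.ofFn s)) →
        IsIso (π₁ ∣_ U) :=
  ⟨X, 𝟙 X, inferInstance, ⟨⊤, by simp, by simp, inferInstance⟩, inferInstance, hX,
    fun _ _ => inferInstance⟩

end Literature.AlgebraicGeometry.Resolution

end
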